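import Summits.QuantumFields.BalabanUV.Beta.GAN24.WhitneyRowDefectEnd
import Summits.QuantumFields.BalabanUV.Beta.GAN24.WhitneyRowDefectBoundDecay
import Literature.MathematicalPhysics.QuantumFieldTheory.Balaban1983to89.B6Ineq2118TwoScaleV1

/-!
# `BalabanUV.Beta.GAN24.WhitneyRowDefectEndFree` — binder row G-an2-4 ∕ (CONV-C), routes R1 ∕ R6 ∕ R7 at `U = 1`: THE VOLUME-FREE ENDs —
# the value step and THE CAUCHY PROPERTY OF BAŁABAN's MINIMISERS UNDER WHITNEY PROLONGATION with ONE constant `C(d, Lc)` for EVERY unit torus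
# (unit b2b-balaban-gan24-p3, gen 49; v1 — `WhitneyRowDefectEnd` with `WhitneyRowDefectBoundDecay`'s volume-free `ρ_j` and the volume-free `Λ = 16(d+1)γ₁`)

NOT IN PRINT; OUR PROOF ([folklore] plumbing BY NAME).  HONEST FRAMING (cell contract, verbatim): «discharging `BetaPertH` makes Bałaban's UV stability UNCONDITIONAL —
a real constructive-QFT result; it is NOT the continuum limit and NOT the Clay problem.»  HONEST DEPENDENCY (verbatim): «continuum YM on T⁴ ⇐ BetaPertH ∧ nine spine
estimates (0/9 proved); BetaPertH ⇐ (D1) ∧ (D4) ∧ CAP+tail; G-an2-4 gates asym, D1 and NE2/3/4.»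

CONTENT (0 sorry, 0 `def`, nothing cited; dimension `d + 1`, every `Lc ≥ 1`):
* §1 **`norm_effAction_le_const`**: `‖effAction k‖ ≤ 16(d+1)·γ₁(d+1)` for EVERY torus — `effAction k ≤ γ₁·curlMatᴴcurlMat` (`effAction_le_curlBound`, twice the printed (1.67)
  upper bound) and `curlEnergy ≤ 16(d+1)·nsq` (`B6Ineq2118TwoScaleV1.d1Sq_le` + `d1Sq_eq_half_curlEnergy`), read in the operator norm (`opNorm_le_of_posSemidef_of_sub_posSemidef`).
* §2 **`effAction_step_le_free`**, **`curlEnergy_HkOp_succ_sub_PcoLev_le_free`** (explicit `C(d, Lc)·(Lc⁻¹)^j·nsq B` bounds), **`cauchy_whitney_HkOp_free`**: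
  `∃ C ≥ 0` (a function of `d, Lc` alone) with, for EVERY unit torus `M`, every level `j` and every datum `B`, (i) `re⟨B,(E_{j+1} − E_j)B⟩ ≤ C·(Lc⁻¹)^j·nsq B` and
  (ii) `scal (j+1)·curlEnergy (H_{Lc^{j+1}}B − PcoLev j (H_{Lc^j}B)) ≤ C·(Lc⁻¹)^j·nsq B`.
HONEST SCOPE.  `U = 1`, torus model, first order; NOT (CONV-C), NOT D1, NOT `BetaPertH`, NOT continuum, NOT Clay; NEVER «G-an2-4 closed».
-/

noncomputable section

namespace Summit.QuantumFields.BalabanUV.Beta.GAN24.WhitneyRowDefectEndFree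

open Matrix
open scoped BigOperators ComplexOrder Matrix.Norms.L2Operator
open Literature.MathematicalPhysics.QuantumFieldTheory.Balaban1983to89
open Literature.MathematicalPhysics.QuantumFieldTheory.Balaban1983to89.B5Prop11Plancherel (Tor fine)
open Literature.MathematicalPhysics.QuantumFieldTheory.Balaban1983to89.B5Prop11Lower (nsq nsq_nonneg star_dotProduct_self)
open Literature.MathematicalPhysics.QuantumFieldTheory.Balaban1983to89.B4Sect5Proof (latticeConst latticeConst_nonneg)
open Literature.MathematicalPhysics.QuantumFieldTheory.Balaban1983to89.B5Hk163Torus (HkOp)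
open Literature.MathematicalPhysics.QuantumFieldTheory.Balaban1983to89.B5Hk163TorusHolderDecay (CdecD CdecD_nonneg)
open Literature.MathematicalPhysics.QuantumFieldTheory.Balaban1983to89.Beta.Ineq167OperatorUpper (gamma1 gamma1_pos)
open Literature.MathematicalPhysics.QuantumFieldTheory.Balaban1983to89.B6Ineq2118TwoScaleV1 (d1Sq_le)
open Summit.QuantumFields.BalabanUV.Beta.GAN24.MonotoneLoewner (posSemidef_of_isHermitian_re_nonneg)
open Summit.QuantumFields.BalabanUV.Beta.GAN24.MonotoneTorusTower (Lev sread hform scal curlEnergy quad_curlMat)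
open Summit.QuantumFields.BalabanUV.Beta.GAN24.MonotoneTorusEffective (effAction effAction_posSemidef effAction_isHermitian)
open Summit.QuantumFields.BalabanUV.Beta.GAN24.MonotoneTorusEffectiveLimit (curlBound curlBound_isHermitian effAction_le_curlBound d1Sq_eq_half_curlEnergy)
open Summit.QuantumFields.BalabanUV.Beta.GAN24.MonotoneTorusSqueeze (PcoLev PcoMat)
open Summit.QuantumFields.BalabanUV.Beta.PropagatorWoodburyFibre (opNorm_le_of_posSemidef_of_sub_posSemidef)
open Summit.QuantumFields.BalabanUV.Beta.GAN24.HkKingOneStep (dec dec_pos)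
open Summit.QuantumFields.BalabanUV.Beta.GAN24.WhitneyRowDefectGauge (squeeze_nsq_honest curlEnergy_HkOp_succ_sub_PcoLev_le)
open Summit.QuantumFields.BalabanUV.Beta.GAN24.WhitneyRowDefectEnd (theta_pow_sq_le)
open Summit.QuantumFields.BalabanUV.Beta.GAN24.WhitneyRowDefectBoundDecay (nsq_honestDefect_le_decay)

variable {d : ℕ} (Lc : ℕ) [NeZero Lc] (M : Fin (d + 1) → ℕ) [hM : ∀ μ, NeZero (M μ)]

/-! ## §1 `Λ` volume-free: `‖effAction k‖ ≤ 16(d+1)·γ₁(d+1)` -/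

/-- **`‖effAction k‖ ≤ 16(d+1)·γ₁(d+1)` FOR EVERY TORUS** — `effAction k ≤ γ₁·curlMatᴴcurlMat ≤ 16(d+1)γ₁·1` in the Loewner order (`effAction_le_curlBound`;
`curlEnergy B = 2⟨∂₁B,∂₁B⟩ ≤ 16(d+1)·nsq B` by `B6Ineq2118TwoScaleV1.d1Sq_le`), read in the operator norm. [folklore] -/
theorem norm_effAction_le_const (k : ℕ) : ‖effAction Lc M k‖ ≤ 16 * ((d : ℝ) + 1) * gamma1 (d + 1) := by
  set a : ℝ := 16 * ((d : ℝ) + 1) * gamma1 (d + 1) with ha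
  have ha0 : 0 ≤ a := by have := gamma1_pos (d + 1); positivity
  -- `a·1 − curlBound` is positive semidefinite
  have hcb : (((a : ℝ) : ℂ) • (1 : Matrix (Tor M × Fin (d + 1)) (Tor M × Fin (d + 1)) ℂ) - curlBound M).PosSemidef := by
    refine posSemidef_of_isHermitian_re_nonneg
      ((Matrix.isHermitian_one.smul (by rw [IsSelfAdjoint, Complex.star_def, Complex.conj_ofReal])).sub (curlBound_isHermitian M)) fun x => ?_
    rw [sub_mulVec, dotProduct_sub, Complex.sub_re, smul_mulVec, one_mulVec, dotProduct_smul, smul_eq_mul, star_dotProduct_self,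
      ← Complex.ofReal_mul, Complex.ofReal_re, curlBound, smul_mulVec, dotProduct_smul, quad_curlMat, smul_eq_mul, ← Complex.ofReal_mul,
      Complex.ofReal_re]
    have h1 := d1Sq_le M x
    rw [d1Sq_eq_half_curlEnergy] at h1
    have hg := (gamma1_pos (d + 1)).le
    have h2 : curlEnergy M x ≤ 16 * ((d : ℝ) + 1) * nsq x := by
      have : (∑ i, ‖x i‖ ^ 2) = nsq x := rfl
      rw [this] at h1; push_cast at h1; linarith
    rw [ha]
    nlinarith [nsq_nonneg x]
  refine opNorm_le_of_posSemidef_of_sub_posSemidef ha0 (effAction_posSemidef Lc M k) ?_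
  have e : ((a : ℝ) : ℂ) • (1 : Matrix (Tor M × Fin (d + 1)) (Tor M × Fin (d + 1)) ℂ) - effAction Lc M k
      = (((a : ℝ) : ℂ) • (1 : Matrix _ _ ℂ) - curlBound M) + (curlBound M - effAction Lc M k) := by abel
  rw [e]
  exact hcb.add (effAction_le_curlBound Lc M k)

/-! ## §2 The volume-free ENDs -/

/-- **THE VALUE STEP WITH ONE CONSTANT FOR EVERY TORUS**: `re⟨B,(effAction (j+1) − effAction j)B⟩ ≤ 2·(16(d+1)γ₁)·R(d,Lc)·(Lc⁻¹)^j·nsq B`,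
`R = (d+1)·K_{d+1}(dec)·(Lc+d+1)·e^{dec(Lc+d+1)}·e^{dec}·CdecD`. [folklore] -/
theorem effAction_step_le_free (j : ℕ) (B : Tor M × Fin (d + 1) → ℂ) :
    (star B ⬝ᵥ ((effAction Lc M (j + 1) - effAction Lc M j) *ᵥ B)).re
      ≤ 2 * (16 * ((d : ℝ) + 1) * gamma1 (d + 1))
          * (((d : ℝ) + 1) * latticeConst (d + 1) (dec d) *
              (((Lc : ℝ) + (d + 1)) * Real.exp (dec d * ((Lc : ℝ) + (d + 1))) * Real.exp (dec d) * CdecD d))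
          * ((Lc : ℝ)⁻¹) ^ j * nsq B := by
  set R := ((d : ℝ) + 1) * latticeConst (d + 1) (dec d) *
    (((Lc : ℝ) + (d + 1)) * Real.exp (dec d * ((Lc : ℝ) + (d + 1))) * Real.exp (dec d) * CdecD d) with hR
  have hR0 : 0 ≤ R := by
    have := latticeConst_nonneg (d + 1) (dec_pos d).le; have := CdecD_nonneg (d := d); positivity
  have hρ0 : 0 ≤ R / (Lc : ℝ) ^ j := div_nonneg hR0 (pow_nonneg (Nat.cast_nonneg _) j)
  have h := (squeeze_nsq_honest Lc M j (norm_effAction_le_const Lc M (j + 1)) hρ0 (nsq_honestDefect_le_decay Lc M j) B).1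
  rw [div_eq_mul_inv, ← inv_pow] at h
  linarith

/-- **THE CAUCHY PROPERTY OF BAŁABAN's MINIMISERS UNDER WHITNEY PROLONGATION, ONE CONSTANT FOR EVERY TORUS**:
`scal (j+1)·curlEnergy (H_{Lc^{j+1}}B − PcoLev j (H_{Lc^j}B)) ≤ (4ΛR + 2ΛR²)·(Lc⁻¹)^j·nsq B` with `Λ = 16(d+1)γ₁(d+1)` and `R = R(d, Lc)` as above. [folklore] -/
theorem curlEnergy_HkOp_succ_sub_PcoLev_le_free (j : ℕ) (B : Tor M × Fin (d + 1) → ℂ) :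
    scal (d := d + 1) Lc (j + 1) * curlEnergy (fine (Lc ^ (j + 1)) M) (HkOp (Lc ^ (j + 1)) M *ᵥ B - PcoLev Lc M j (HkOp (Lc ^ j) M *ᵥ B))
      ≤ (4 * (16 * ((d : ℝ) + 1) * gamma1 (d + 1))
            * (((d : ℝ) + 1) * latticeConst (d + 1) (dec d) *
                (((Lc : ℝ) + (d + 1)) * Real.exp (dec d * ((Lc : ℝ) + (d + 1))) * Real.exp (dec d) * CdecD d))
          + 2 * (16 * ((d : ℝ) + 1) * gamma1 (d + 1))
            * (((d : ℝ) + 1) * latticeConst (d + 1) (dec d) *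
                (((Lc : ℝ) + (d + 1)) * Real.exp (dec d * ((Lc : ℝ) + (d + 1))) * Real.exp (dec d) * CdecD d)) ^ 2)
        * ((Lc : ℝ)⁻¹) ^ j * nsq B := by
  set R := ((d : ℝ) + 1) * latticeConst (d + 1) (dec d) *
    (((Lc : ℝ) + (d + 1)) * Real.exp (dec d * ((Lc : ℝ) + (d + 1))) * Real.exp (dec d) * CdecD d) with hR
  set Λ := 16 * ((d : ℝ) + 1) * gamma1 (d + 1) with hΛ
  set θj := ((Lc : ℝ)⁻¹) ^ j with hθ
  have hR0 : 0 ≤ R := by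
    have := latticeConst_nonneg (d + 1) (dec_pos d).le; have := CdecD_nonneg (d := d); positivity
  have hΛ0 : 0 ≤ Λ := by have := gamma1_pos (d + 1); positivity
  have hρ0 : 0 ≤ R / (Lc : ℝ) ^ j := div_nonneg hR0 (pow_nonneg (Nat.cast_nonneg _) j)
  have h := curlEnergy_HkOp_succ_sub_PcoLev_le Lc M j (norm_effAction_le_const Lc M (j + 1)) hρ0 (nsq_honestDefect_le_decay Lc M j) B
  rw [div_eq_mul_inv, ← inv_pow, ← hθ] at h
  have hB0 : 0 ≤ nsq B := nsq_nonneg B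
  have hsq := theta_pow_sq_le Lc j
  rw [← hθ] at hsq
  refine h.trans ?_
  have e : (4 * Λ * (R * θj) + 2 * Λ * (R * θj) ^ 2) * nsq B = (4 * Λ * R) * θj * nsq B + (2 * Λ * R ^ 2) * (θj ^ 2) * nsq B := by ring
  rw [e]
  have hle : (2 * Λ * R ^ 2) * (θj ^ 2) * nsq B ≤ (2 * Λ * R ^ 2) * θj * nsq B :=
    mul_le_mul_of_nonneg_right (mul_le_mul_of_nonneg_left hsq (by positivity)) hB0
  linarith

/-- **THE CENSUS SENTENCE, VOLUME-FREE**: there is `C = C(d, Lc) ≥ 0` such that for EVERY unit torus `M`, every level `j` and every datum `B`,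
(i) `re⟨B,(effAction (j+1) − effAction j)B⟩ ≤ C·(Lc⁻¹)^j·nsq B` (route R1 at `U = 1` closed at first order, uniformly in the volume) and
(ii) `scal (j+1)·curlEnergy (H_{Lc^{j+1}}B − PcoLev j (H_{Lc^j}B)) ≤ C·(Lc⁻¹)^j·nsq B` (the Cauchy property of Bałaban's minimisers under Whitney prolongation in the scaled curl
energy — route R7 (iii)'s energy-norm leg rate ∕ route R6's (CONS)-class input at `U = 1`, uniformly in the volume); geometric for `Lc ≥ 2`. [folklore] -/
theorem cauchy_whitney_HkOp_free :
    ∃ C : ℝ, 0 ≤ C ∧ ∀ (M : Fin (d + 1) → ℕ) [∀ μ, NeZero (M μ)] (j : ℕ) (B : Tor M × Fin (d + 1) → ℂ),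
      (star B ⬝ᵥ ((effAction Lc M (j + 1) - effAction Lc M j) *ᵥ B)).re ≤ C * ((Lc : ℝ)⁻¹) ^ j * nsq B
        ∧ scal (d := d + 1) Lc (j + 1) * curlEnergy (fine (Lc ^ (j + 1)) M) (HkOp (Lc ^ (j + 1)) M *ᵥ B - PcoLev Lc M j (HkOp (Lc ^ j) M *ᵥ B))
            ≤ C * ((Lc : ℝ)⁻¹) ^ j * nsq B := by
  set R := ((d : ℝ) + 1) * latticeConst (d + 1) (dec d) *
    (((Lc : ℝ) + (d + 1)) * Real.exp (dec d * ((Lc : ℝ) + (d + 1))) * Real.exp (dec d) * CdecD d) with hR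
  set Λ := 16 * ((d : ℝ) + 1) * gamma1 (d + 1) with hΛ
  have hR0 : 0 ≤ R := by
    have := latticeConst_nonneg (d + 1) (dec_pos d).le; have := CdecD_nonneg (d := d); positivity
  have hΛ0 : 0 ≤ Λ := by have := gamma1_pos (d + 1); positivity
  refine ⟨4 * Λ * R + 2 * Λ * R ^ 2, by positivity, fun M _ j B => ⟨?_, ?_⟩⟩
  · have h := effAction_step_le_free Lc M j B
    have hθ : 0 ≤ ((Lc : ℝ)⁻¹) ^ j := pow_nonneg (inv_nonneg.mpr (Nat.cast_nonneg _)) j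
    have hB0 : 0 ≤ nsq B := nsq_nonneg B
    rw [← hR, ← hΛ] at h
    nlinarith [mul_nonneg (mul_nonneg (mul_nonneg hΛ0 hR0) hθ) hB0, mul_nonneg (mul_nonneg (mul_nonneg hΛ0 (sq_nonneg R)) hθ) hB0]
  · have h := curlEnergy_HkOp_succ_sub_PcoLev_le_free Lc M j B
    rw [← hR, ← hΛ] at h
    exact h

end Summit.QuantumFields.BalabanUV.Beta.GAN24.WhitneyRowDefectEndFree

end
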